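import Literature.Algebra.Homology.DiscreteRepInvariantsExtOneVanishing
import Literature.NumberTheory.GaloisRepresentations.PresentationGaloisModulesS
import Literature.NumberTheory.GaloisRepresentations.GalLayerSystemFreePresentationVanishing
import Literature.NumberTheory.GaloisRepresentations.IdeleBarKSMaps
import Literature.NumberTheory.GaloisRepresentations.IdeleProjectionS
import HarnessLib

/-!
# `Ext¹_{C_{G_S}}(P^S, J_{K_S}) = 0` and `Ext¹_{C_{G_S}}(P^S, I_S) = 0` for the lattice `P^S` of the `S`-presentation;
# the boundary `Hom_{G_S}(N₁^S, I_S) ↠ Ext¹_{G_S}(M, I_S)` is onto (Harari Lemma 17.23 / Prop. 17.26; Milne I Lemma 4.13)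

Topic `NumberTheory/GaloisRepresentations`; namespace `Literature.NumberTheory.GaloisRepresentations.IdeleClassBar`.  Sequel to
`Algebra/Homology/DiscreteRepInvariantsExtOneVanishing.lean` (`Ext¹_{C_Γ}(Inf X, Y) = 0 ⟹ Ext¹_{C_{Γ/N}}(X, Y^N) = 0`), door-c4's
`GalLayerSystemFreePresentationVanishing.lean` (`Ext¹_{C_{Γ_K}}(P, J̄) = 0`, the idèle Hilbert 90 over all layers), -w7 g11's
`PresentationGaloisModulesS.lean` (`presentationComplexS ρ S`, `inflPresentationSIso₂`) and -w6 g10's `IdeleBarKSMaps.lean`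
(`inclKS ≫ truncKS = 𝟙`: `I_S` is a retract of `J_{K_S}`).  Two plumbing morphisms with bodies (`inclKSD`, `truncKSD`, the
`C_{G_S}`-forms of -w6 g10's maps) and theorems; NO named fact, no `sorry`, no instance, no notation; number fields in `Type`.

THE MATHEMATICS (Harari, *Galois Cohomology and CFT*, Lemma 17.23 and the proof of Prop. 17.26, in degree `1`:
`Ext¹_{G_S}(P, I_S) = lim→_F H¹(Gal(F/K(M)), J_{F,S})^r = 0` by Shapiro and Hilbert 90; Milne ADT I Lemma 4.13).  For a finite
Galois module `ρ` unramified outside `S` (`hur : N_S ≤ ker ρ`) with `S`-presentation `0 → N₁^S → P^S → M → 0` in `C_{G_S}`: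
* `Ext¹_{C_{G_S}}(P^S, J_{K_S}) = 0` (`J_{K_S} = J̄^{N_S} = ideleBarKSD K S`): door-c4's `Ext¹_{C_{Γ_K}}(P, J̄) = 0` transported along
  `Inf P^S ≅ P`, then the Hochschild–Serre edge of the previous file (`P^S` is a lattice, `moduleProjective_presentationComplexS_X₂`);
* `Ext¹_{C_{G_S}}(P^S, I_S) = 0` — `I_S` is a retract of `J_{K_S}` in `C_{G_S}` (`inclKSD ≫ truncKSD = 𝟙`);
* hence **`exists_extClass_comp_mk₀_eq`**: every class of `Ext¹_{C_{G_S}}(M, I_S)` (`M = (presentationComplexS ρ S).X₃`) is the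
  boundary `δ(f)` of a `G_S`-morphism `f : N₁^S ⟶ I_S` — the idèle part of Milne's `Ext` road reads through the
  `Hom`-level `S`-readout (`HomDualIdeleReadoutS.readoutS`).
The `E_S`-analogue is FALSE (`H¹(Gal(K_S/E), E_S) ≅ Cl_S(E)`), which is why the lane's Poitou–Tate road for `G_S` runs on `Ext`.

Cell bsd-eis, lane «PT-Ш-S-TC», brick D4b step F2f (seat bsd-line-x1-p1-w6 gen 11).  HONEST FRAMING: bookkeeping over landed
theorems; no duality theorem and no case of BSD is proved here.

## References
* D. Harari, *Galois Cohomology and Class Field Theory*, Universitext, Springer (2020), §17.4 Lemma 17.23, Prop. 17.26 (proof),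
  §4.3 Remark 4.24. [Harari2020]
* J. S. Milne, *Arithmetic Duality Theorems*, 2nd ed. (2006), I Lemma 4.13 (proof), I §0 (0.8). [MilneADT2006]
* J.-P. Serre, *Galois Cohomology*, Springer (1997), I §2.6 (b), II §1.2 (Hilbert 90). [SerreGaloisCohomology1997]
-/

noncomputable section

open NumberField IsDedekindDomain CategoryTheory CategoryTheory.Abelian
open Field (absoluteGaloisGroup)
open Literature.NumberTheory.Automorphic Literature.Algebra.Homology Literature.Algebra.Homology.DiscreteRep
open scoped Classical

namespace Literature.NumberTheory.GaloisRepresentations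

namespace IdeleClassBar

open FreePresentation

variable (K : Type) [Field K] [NumberField K] (S : Finset (HeightOneSpectrum (𝓞 K)))

/-! ## §1. `J_{K_S}` in `C_{G_S}` and the retraction `I_S ↪ J_{K_S} ↠ I_S` -/

/-- **`J_{K_S} = J̄^{N_S}` as an object of `C_{G_S}`** (-w7 g11's `invariantsQuotD`; its underlying representation is -w6 g10's
`ideleBarKS K S`, definitionally). [cite: Harari2020, §17.4 (17.1)] -/
abbrev ideleBarKSD : DiscreteRepCat ℤ (GaloisGroupUnramifiedOutside K (↑S : Set (HeightOneSpectrum (𝓞 K)))) :=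
  (invariantsQuotD ℤ (ramificationSubgroup K (↑S : Set (HeightOneSpectrum (𝓞 K))))).obj (ideleBarD K)

/-- `(ideleBarKSD K S).obj = ideleBarKS K S` (definitional). [cite: Harari2020, §17.4 (17.1)] -/
theorem ideleBarKSD_obj : (ideleBarKSD K S).obj = ideleBarKS K S := rfl

/-- **`I_S ↪ J_{K_S}` in `C_{G_S}`.** [cite: Harari2020, §17.4 (17.1)] -/
def inclKSD : truncIdeleBarD K S ⟶ ideleBarKSD K S := ObjectProperty.homMk (inclKS K S)

/-- **`J_{K_S} ↠ I_S` (truncation) in `C_{G_S}`.** [cite: Harari2020, §17.4 (17.1)] -/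
def truncKSD : ideleBarKSD K S ⟶ truncIdeleBarD K S := ObjectProperty.homMk (truncKS K S)

/-- **`I_S` is a retract of `J_{K_S}` in `C_{G_S}`: `incl ≫ trunc = 𝟙`.** [cite: Harari2020, §17.4 (17.1)] -/
@[simp] theorem inclKSD_comp_truncKSD : inclKSD K S ≫ truncKSD K S = 𝟙 (truncIdeleBarD K S) :=
  ObjectProperty.hom_ext _ (inclKS_comp_truncKS K S)

/-- `Extⁿ(X, A) = 0` for a retract `A` of `B` with `Extⁿ(X, B) = 0` (any abelian category; `Ext(X, –)` is additive).
[cite: Weibel1994, §2.7 (Ext as a bifunctor), Lemma 6.3.2] -/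
private theorem ext_eq_zero_of_retract {C : Type*} [Category C] [Abelian C] [HasExt.{0} C] {X A B : C} (i : A ⟶ B) (r : B ⟶ A)
    (hir : i ≫ r = 𝟙 A) {n : ℕ} (hB : ∀ e : Ext X B n, e = 0) (e : Ext X A n) : e = 0 := by
  have h := congrArg (fun y => y.comp (Ext.mk₀ r) (add_zero n)) (hB (e.comp (Ext.mk₀ i) (add_zero n)))
  simpa only [Ext.comp_assoc_of_second_deg_zero, Ext.mk₀_comp_mk₀, hir, Ext.comp_mk₀_id, Ext.zero_comp] using h

/-- `Extⁿ(A, Y) = 0` from `Extⁿ(B, Y) = 0` along an isomorphism `A ≅ B` (first variable). [cite: Weibel1994, §2.7] -/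
private theorem ext_eq_zero_of_iso_left {C : Type*} [Category C] [Abelian C] [HasExt.{0} C] {A B Y : C} (i : A ≅ B) {n : ℕ}
    (hB : ∀ e : Ext B Y n, e = 0) (e : Ext A Y n) : e = 0 := by
  have h : e = (Ext.mk₀ i.hom).comp ((Ext.mk₀ i.inv).comp e (zero_add n)) (zero_add n) := by
    rw [Ext.mk₀_comp_mk₀_assoc, Iso.hom_inv_id, Ext.mk₀_id_comp]
  rw [h, hB ((Ext.mk₀ i.inv).comp e (zero_add n)), Ext.comp_zero]

/-! ## §2. The lattice `P^S` and the vanishing of `Ext¹_{C_{G_S}}(P^S, J_{K_S})`, `Ext¹_{C_{G_S}}(P^S, I_S)` -/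

variable {K}
variable {M : Type} [AddCommGroup M] [TopologicalSpace M] [DiscreteTopology M] [Finite M]
variable (ρ : DiscreteGaloisModule K M)

/-- All `ℤ`-module structures on an abelian group agree: projectivity transports between them. [folklore] -/
private theorem moduleProjective_int_of_inst {V : Type} [AddCommGroup V] (i j : Module ℤ V)
    (h : @Module.Projective ℤ _ V _ i) : @Module.Projective ℤ _ V _ j := by
  obtain rfl : i = j := Subsingleton.elim _ _
  exact h

/-- **`P^S` is a lattice**: the vectors of `(presentationComplexS ρ S).X₂ = (Inf ℤ[Γ/U]ᵐ)^{N_S}` form a projective (free)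
`ℤ`-module — all of `P` is `N_S`-invariant (`hur`), and `P` is free (`moduleFree_presLattice`).
[cite: MilneADT2006, I Lemma 4.13 (proof)] [cite: Harari2020, Prop. 17.26 (proof)] -/
theorem moduleProjective_presentationComplexS_X₂ (hur : ramificationSubgroup K (↑S : Set (HeightOneSpectrum (𝓞 K))) ≤ ContinuousRep.ker ρ) :
    @Module.Projective ℤ _ (presentationComplexS ρ (↑S : Set (HeightOneSpectrum (𝓞 K)))).X₂.obj.V _
      (presentationComplexS ρ (↑S : Set (HeightOneSpectrum (𝓞 K)))).X₂.obj.hV2 := by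
  letI : Module ℤ (presLattice (presentationLayer ρ) (presentationRank ρ)).obj.V :=
    (presLattice (presentationLayer ρ) (presentationRank ρ)).obj.hV2
  -- `P` is projective for its representation module structure
  have hP : @Module.Projective ℤ _ (presLattice (presentationLayer ρ) (presentationRank ρ)).obj.V _
      (presLattice (presentationLayer ρ) (presentationRank ρ)).obj.hV2 := by
    obtain ⟨i₀, hfree⟩ : ∃ i₀ : Module ℤ (presLattice (presentationLayer ρ) (presentationRank ρ)).obj.V,
        @Module.Free ℤ (presLattice (presentationLayer ρ) (presentationRank ρ)).obj.V _ _ i₀ :=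
      ⟨_, moduleFree_presLattice (presentationLayer ρ) (presentationRank ρ)⟩
    have hi : i₀ = (presLattice (presentationLayer ρ) (presentationRank ρ)).obj.hV2 := Subsingleton.elim _ _
    subst hi
    haveI := hfree
    exact Module.Projective.of_free
  haveI := hP
  -- all of `P` is `N_S`-invariant
  let e : (presentationComplexS ρ (↑S : Set (HeightOneSpectrum (𝓞 K)))).X₂.obj.V ≃ₗ[ℤ]
      (presLattice (presentationLayer ρ) (presentationRank ρ)).obj.V :=
    LinearEquiv.ofTop _ (eq_top_iff.2 fun v _ n =>
      presentationComplex_X₂_trivial_of_le ρ (↑S : Set (HeightOneSpectrum (𝓞 K))) hur n.1 n.2 v)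
  exact moduleProjective_int_of_inst _ _ (Module.Projective.of_equiv e.symm)

/-- **`Ext¹_{C_{Γ_K}}(Inf P^S, J̄) = 0`** (door-c4's `Ext¹_{C_{Γ_K}}(P, J̄) = 0` along `Inf P^S ≅ P`).
[cite: MilneADT2006, I Lemma 4.13 (proof)] [cite: SerreGaloisCohomology1997, II §1.2] -/
theorem ext_one_inf_presentationComplexS_X₂_ideleBarD_eq_zero (hur : ramificationSubgroup K (↑S : Set (HeightOneSpectrum (𝓞 K))) ≤ ContinuousRep.ker ρ)
    (e : Ext ((inflQuotFunctor ℤ (ramificationSubgroup K (↑S : Set (HeightOneSpectrum (𝓞 K))))).obj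
      (presentationComplexS ρ (↑S : Set (HeightOneSpectrum (𝓞 K)))).X₂) (ideleBarD K) 1) : e = 0 :=
  ext_eq_zero_of_iso_left (inflPresentationSIso₂ ρ (↑S : Set (HeightOneSpectrum (𝓞 K))) hur)
    (fun e' => ext_presLattice_ideleBarD_eq_zero (presentationLayer ρ) (presentationRank ρ) e') e

/-- **`Ext¹_{C_{G_S}}(P^S, J_{K_S}) = 0`** (Harari Lemma 17.23 / idèle Hilbert 90, through the Hochschild–Serre edge
`ext_one_invariantsQuotD_eq_zero_of_infl`). [cite: Harari2020, Lemma 17.23, §4.3 Remark 4.24] [cite: MilneADT2006, I Lemma 4.13 (proof)] -/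
theorem ext_one_presentationComplexS_X₂_ideleBarKSD_eq_zero (hur : ramificationSubgroup K (↑S : Set (HeightOneSpectrum (𝓞 K))) ≤ ContinuousRep.ker ρ)
    (e : Ext (presentationComplexS ρ (↑S : Set (HeightOneSpectrum (𝓞 K)))).X₂ (ideleBarKSD K S) 1) : e = 0 := by
  haveI := moduleProjective_presentationComplexS_X₂ S ρ hur
  exact ext_one_invariantsQuotD_eq_zero_of_infl (ramificationSubgroup K (↑S : Set (HeightOneSpectrum (𝓞 K)))) _ (ideleBarD K)
    (fun e' => ext_one_inf_presentationComplexS_X₂_ideleBarD_eq_zero S ρ hur e') e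

/-- **`Ext¹_{C_{G_S}}(P^S, I_S) = 0`** (`I_S` is a retract of `J_{K_S}`). [cite: Harari2020, Lemma 17.23, Prop. 17.26 (proof)]
[cite: MilneADT2006, I Lemma 4.13 (proof)] -/
theorem ext_one_presentationComplexS_X₂_truncIdeleBarD_eq_zero (hur : ramificationSubgroup K (↑S : Set (HeightOneSpectrum (𝓞 K))) ≤ ContinuousRep.ker ρ)
    (e : Ext (presentationComplexS ρ (↑S : Set (HeightOneSpectrum (𝓞 K)))).X₂ (truncIdeleBarD K S) 1) : e = 0 :=
  ext_eq_zero_of_retract (inclKSD K S) (truncKSD K S) (inclKSD_comp_truncKSD K S)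
    (fun e' => ext_one_presentationComplexS_X₂_ideleBarKSD_eq_zero S ρ hur e') e

/-! ## §3. The boundary `Hom_{G_S}(N₁^S, I_S) → Ext¹_{G_S}(M, I_S)` is onto -/

/-- **Every class of `Ext¹_{C_{G_S}}(M, I_S)` is a boundary `δ(f)`, `f : N₁^S ⟶ I_S`** (`M = (presentationComplexS ρ S).X₃`;
contravariant long exact `Ext(–, I_S)`-sequence of the `S`-presentation and §2). [cite: MilneADT2006, I Lemma 4.13, I §0 (0.8)]
[cite: Harari2020, Prop. 17.26 (proof)] -/
theorem exists_extClass_comp_mk₀_eq (hur : ramificationSubgroup K (↑S : Set (HeightOneSpectrum (𝓞 K))) ≤ ContinuousRep.ker ρ)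
    (x : Ext (presentationComplexS ρ (↑S : Set (HeightOneSpectrum (𝓞 K)))).X₃ (truncIdeleBarD K S) 1) :
    ∃ f : (presentationComplexS ρ (↑S : Set (HeightOneSpectrum (𝓞 K)))).X₁ ⟶ truncIdeleBarD K S,
      (presentationComplexS_shortExact ρ (↑S : Set (HeightOneSpectrum (𝓞 K))) hur).extClass.comp (Ext.mk₀ f)
        (add_zero 1) = x := by
  obtain ⟨x₁, hx₁⟩ := Ext.contravariant_sequence_exact₃
    (presentationComplexS_shortExact ρ (↑S : Set (HeightOneSpectrum (𝓞 K))) hur) _ x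
    (ext_one_presentationComplexS_X₂_truncIdeleBarD_eq_zero S ρ hur _) (add_zero 1)
  obtain ⟨f, rfl⟩ := (Ext.mk₀_bijective _ _).2 x₁
  exact ⟨f, hx₁⟩

/-- The same surjectivity, stated for the additive boundary map `f ↦ δ_S ∘ [f]`. [cite: MilneADT2006, I Lemma 4.13] -/
theorem extClass_comp_mk₀_surjective (hur : ramificationSubgroup K (↑S : Set (HeightOneSpectrum (𝓞 K))) ≤ ContinuousRep.ker ρ) :
    Function.Surjective fun f : (presentationComplexS ρ (↑S : Set (HeightOneSpectrum (𝓞 K)))).X₁ ⟶ truncIdeleBarD K S =>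
      (presentationComplexS_shortExact ρ (↑S : Set (HeightOneSpectrum (𝓞 K))) hur).extClass.comp (Ext.mk₀ f) (add_zero 1) :=
  fun x => exists_extClass_comp_mk₀_eq S ρ hur x

end IdeleClassBar

end Literature.NumberTheory.GaloisRepresentations

end
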